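import Summits.CriticalPhenomena.CardyFormulaZ2.Theses.CardyUSTContinuation
import Summits.CriticalPhenomena.CardyFormulaZ2.Theorems.CardyUSTContinuationTargetStubWindowGlue
import Summits.CriticalPhenomena.CardyFormulaZ2.Theorems.CardyUSTContinuationTargetAccumulation
import Summits.CriticalPhenomena.CardyFormulaZ2.Theorems.CardyUSTContinuationTargetUniform
import Summits.CriticalPhenomena.CardyFormulaZ2.Theorems.CardyUSTContinuationBernoulliEndpoint

/-!
# Skeleton v8 for crux `Target` — item stmt-CriticalPhenomena-6046, route `CardyUSTContinuation`
(line `registered` = the planners' birth skeleton `Cruxes/Target/Lines/birth.lean`, sha 6f761b7d…;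
v2 2026-08-17 by lead c2; v3/v4 2026-08-17 by lead c3 `prover-line-stmt-CriticalPhenomena-6046-c3-0`;
v4 = v3 with stub G LANDED (imported) and the window-assembly corollary added;
v5 2026-08-17 by lead c4 `prover-line-stmt-CriticalPhenomena-6046-c4-0` = ACCUMULATION cut:
Vitali–Porter at full strength — stub W (window) is replaced by the weaker registered stub W′
`stub_accLimit` (X_S along a set of fugacities ACCUMULATING at one point of (0,1]) and the glue
G′ `stub_accGlue : A → W′ → SmallFugacityLimit` (proved in this lead's Theorems file
`CardyUSTContinuationTargetAccumulation.lean`; W → W′ proved below);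
v6 = v5 with stub G′ LANDED (p152601, imported): open stubs A, W′ only)

## v7/v8 — UNIFORM cut (lead c5 `prover-line-stmt-CriticalPhenomena-6046-c5-0`, 2026-08-17; v8 = v7 with stub UG LANDED p155359 and imported: open stubs A, W′ only)

Vitali–Porter is run in its UNIFORM form (uniform convergence on compact sub-segments along the
filter `𝓝[>] 0`, sequences extracted from a failure of uniformity by
`Filter.exists_seq_forall_of_frequently`): under X_A, the accumulation form W′ gives not only the
pointwise Miller–Werner limit at every `t ∈ (0,1]` (v5) but `u_R(·,δ) → U(·,η)` UNIFORMLY on every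
`[t₁,1]`, hence the crossing limit `U c` along ANY moving fugacity `τ δ → c ∈ (0,1]` — statement M
(`Sig.movingFugacityLimit`), in particular CARDY's formula along any `q_δ → 1⁻` (Theorems file
`CardyUSTContinuationTargetUniform.lean`: `cardyUST_target_cardy_movingFugacity`).  Registered stubs
of v7: A `stub_uniformAnalyticExtension` (= stmt-6047 BY NAME), W′ `stub_accLimit`, UG
`stub_uniformGlue : A → W′ → M` — LANDED p155359 (lead c5's Theorems file), so v8 registers A, W′ only;
composition `Target_of : A → W′ → Target` through UG and the sorry-free
`smallFugacityLimit_of_movingFugacity : M → SmallFugacityLimit` (constant schedules); the v6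
composition through the landed G′ is kept as `Target_of_acc`.  Chain (sorry-free / landed):
`Target → M → SmallFugacityLimit → W → W′` and, under A, `W′ → M` (UG).  Numerics of this cycle:
CHEAPEST FALSIFIER (4) RUN at `t = 1` (REPORT-c5.md in `Cruxes/Target/`): the percolation covariance
`Cov(1_cross ; |ω| + 2k^joint)` converges to `∂_t U(1,η)` on seven rectangle families although
`E[#pivotal]/4 ~ L^{3/4}` diverges — `Target` survives its own falsifier.
Wave (c5, cycle 5): none — A is stmt-6047 (own chain 6047-c4, Schottky reduction landed), W′ ⇐ W ⇐
stmt-6048 (own chain); UG is mine and lands now.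

## v5 — ACCUMULATION cut (lead c4): a set of uniqueness suffices under X_A

Under X_A the family of analytic extensions is normal on the thickened segment, so convergence to
the Miller–Werner law is needed only on a SET OF UNIQUENESS: for every conformal rectangle `R`,
some `c ∈ (0,1]` with `∃ᶠ t in 𝓝[≠] c, t ∈ (0,1] ∧ R.HasCrossingLimit (u_R(t,·)) (U t)` — any
sequence of fugacities `tₙ → c`, `tₙ ≠ c` (e.g. `qₙ = tₙ² ↑ 1` at the percolation point).  The
same Theorems file records the DERIVATIVE consequence `cardyUST_target_derivWithin`: under
`Target`, `∂_t u_R(t,δ) → ∂_t U(t,η)` for every `t ∈ (0,1]` (Weierstrass) — at `t = 1` a statement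
about Bernoulli(1/2) bond percolation alone (a Monte-Carlo falsifier of `Target` at `q = 1`).
Registered stubs of v5: A `stub_uniformAnalyticExtension` (= stmt-6047 BY NAME), W′
`stub_accLimit`, G′ `stub_accGlue` — G′ LANDED (p152601), so v6 registers A, W′ only.
Composition `Target_of : A → W′ → Target` (G′ discharged inside).
Wave (c4, cycle 4): none — A is stmt-6047 (own lead chain 6047-c0…c3), W′ ⇐ W ⇐ stmt-6048 (own
lead chain 6048-c0…c2), G′ is mine.  Chain of weakenings, all sorry-free below / landed:
`SmallFugacityLimit → W` (`windowLimit_of_smallFugacityLimit`) `→ W′` (`accLimit_of_windowLimit`).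

Sub-problem `CardyFormulaZ2` (statement `_root_.CardyFormulaZ2`).  Crux decl:
`Summit.CriticalPhenomena.CardyFormulaZ2.Theses.CardyUSTContinuation.Target` (auto-crux, rank 0:
the route thesis `X = X_S ∧ X_A`, i.e. `SmallFugacityLimit ∧ UniformAnalyticExtension` with the
shared `let`s `Z, U, uJ` inlined; `target_iff : Target ↔ SmallFugacityLimit ∧
UniformAnalyticExtension := Iff.rfl`, glue `cruxesGiveTarget_proof` landed).  NOTE: the tree
directory `Cruxes/Target/` is shared with the `Target` cruxes of other routes of this sub (e.g.
stmt-CriticalPhenomena-6431, CardyFlipRusso); THIS file belongs to stmt-6046 only.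

## v3 — RIGIDITY cut (lead c3): the window form of X_S suffices under X_A

What only the conjunction sees: under the Lee–Yang crux X_A (`UniformAnalyticExtension`: for
every `t₁ ∈ (0,1)`, δ-uniform bounded analytic extensions of `t ↦ u_R(t,δ)` to one complex
`ρ`-neighbourhood of `[t₁,1]`), together with the LANDED `continuumFamily_proof` (analytic
continuation of the Miller–Werner law `U(·,η)` near `[0,1]`, stmt-6052) and Vitali–Porter on the
convex `ρ`-thickening (the engine of the landed `vitaliContinuation_proof`, stmt-6053, generalised
from the endpoint `t = 1` to every point of the thickening), convergence `u_R(t,δ) → U(t,η)` on ANY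
real window `(a,b) ⊆ (0,1]` propagates to EVERY `t ∈ (0,1]`.  Hence the registered stubs of v3:

* STUB A `stub_uniformAnalyticExtension : UniformAnalyticExtension` — the sibling crux
  stmt-CriticalPhenomena-6047 BY NAME (open-problem; the route's kill criterion; line lead 6047-c2
  live: `stub_riemann` ✓p145158, `stub_maxModulus` ✓p145160, `stub_ratioToCrux` ✓, `stub_zeroCancel`,
  `stub_annulusBound` open; falsifier (2): argument-principle zero count 0 in [-0.5,1.6]×[-0.9,0.9]
  for 25 boxes).
* STUB W `stub_windowLimit` — the WINDOW form of X_S (the shared `let`s `Z, U, uJ` CHARACTERISED by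
  equations, `∀ Z U uJ, (Z = …) → (U = …) → (uJ = …) → …`, so that the registered signature is
  `:=`-free): for every conformal rectangle `R` there is a
  window `(a,b)`, `0 < a < b ≤ 1`, on which the jointly-wired self-dual FK(`q = t²`) crossing
  probabilities `u_R(t,δ)` have crossing limit the Miller–Werner law `U(t,·)` in joint wiring.
  STRICTLY WEAKER than the sibling crux stmt-CriticalPhenomena-6048 (`SmallFugacityLimit`: a
  window `(0,t₀)` abutting the marginal tree point), see `windowLimit_of_smallFugacityLimit` below
  (sorry-free) — so W is not false unless stmt-6048 is; its engine need not work at `t → 0⁺`.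
* STUB G `stub_windowGlue : UniformAnalyticExtension → W → SmallFugacityLimit` — the rigidity glue
  (LANDED by lead c3, p149449; Vitali on the thickened segment + `continuumFamily_proof`; this lead lands it at
  once as `Theorems/CardyUSTContinuationTargetStubWindowGlue.lean`, together with
  `cardyUST_target_iff_window : Target ↔ UniformAnalyticExtension ∧ W` and
  `cardyUST_target_allFugacity : Target → ∀ R, ∀ t ∈ (0,1], R.HasCrossingLimit (u_R(t,·)) (U t)` — the crux
  pins the Miller–Werner law for EVERY `q = t² ∈ (0,1]`, so the route's CHEAPEST FALSIFIER (3) at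
  any single `t ∈ (0,1]` tests `Target` itself).

Composition (v4): `Target_of : stub A → stub W → Target` (kernel-checked: `⟨G A W, A⟩` after unfolding,
G = the landed `stub_windowGlue`).  Hardest stub: A (held by lead 6047-c2).  Wave (c3, cycle 3): none — A is held by
6047-c2, W is implied by stmt-6048 held by 6048-c2 (one seat per stub), G is mine and lands now.
v2's stub S (`stub_smallFugacityLimit` = stmt-6048 by name) is RETIRED from this skeleton in
favour of the weaker W (S → W is `windowLimit_of_smallFugacityLimit`).

Kept from v1/v2 (kernel-checked, no `sorry`): the birth cut A1/A2 of X_A and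
`uniformAnalyticExtension_iff : UniformAnalyticExtension ↔ ZeroFreeExtension ∧ UniformRatioBound`.

Junk audit of the CONJUNCTION (c2, re-checked c3): `HasCrossingLimit` quantifies over uniformizing
data `(φ, x)` (cross-ratio ∈ (0,1)); `fkDomainMeasure` at `p = t/(1+t)`, `q = t²` is a probability
measure for `t > 0`; degenerate discrete arcs are excluded eventually in `δ`
(`CardyUniqueLimitNegDegenerateArcsRefutation`); `Target → CardyFormulaZ2` by the landed
`assembly_proof` — no refutation of `X_S ∧ X_A` is cheaper than refuting a conjunct; none in reach.

Disproof used: none exists for this crux (`ledger crux ls stmt-CriticalPhenomena-6046`: no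
`Disproof.lean`; no `Theorems/Target/Negative/`).

Sources: LeeYang1952, LebowitzPenrose1968, arXiv:1702.02919 (Miller–Werner), arXiv:2603.06268
(DKLM p. 11), arXiv:1406.7710 (GMT), arXiv:cond-mat/0102090 (Kim–Creswick §3), Grimmett2006.

## Checks (lead c3, 2026-08-17)

* `lean check --json` of this file (v8): rc 0, errors [], sorries 2 = `stub_uniformAnalyticExtension`,
  `stub_accLimit` (UG landed p155359, G′ landed p152601, G landed p149449);
  `Target_of`, `target_iff`, `windowLimit_of_smallFugacityLimit`, the A1/A2 lemmas and the
  `example`s are sorry-free.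
* BC3 probe record (planner seat, v1): no stub statement gives `Target` or `CardyFormulaZ2` by
  `exact? | simpa | aesop` (17/17 fail); v3's W is weaker than v1's S, G is an implication between
  route statements (its conclusion `SmallFugacityLimit` alone does not give `Target`).
-/

noncomputable section

open scoped Topology
open Filter Set
open Summit.CriticalPhenomena.CardyFormulaZ2.Theses.CardyUSTContinuation

namespace Summit.CriticalPhenomena.CardyFormulaZ2.Cruxes.Target.CardyUSTContinuationBirth

/-! ### The birth cut of `UniformAnalyticExtension` (v1; kept for the record; proved equivalent to stub A below)

`uJ` is the route's jointly-wired self-dual FK crossing probability, copied verbatim from the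
route file (same `let`). -/

/-- STATEMENT A1 — δ-uniform zero-free neighbourhood (analytic EXTENSION, no bound): for every
conformal rectangle `R` and `t₁ ∈ (0,1)` there is `ρ > 0` such that, eventually as `δ → 0⁺`,
`t ↦ u_R(t, δ)` on `[t₁, 1]` is the restriction of a function analytic on the complex
`ρ`-neighbourhood of `[t₁, 1]`. -/
def ZeroFreeExtension : Prop :=
  let uJ : Literature.Probability.RandomPlanarGeometry.ConformalRectangle → ℝ → ℝ → ℝ := fun R t δ => if h : 0 < δ then (@Literature.Probability.LatticeModels.fkDomainMeasure R.carrier δ (t / (1 + t)) (t ^ 2) (R.arc 0 ∪ R.arc 2) (Literature.Probability.LatticeModels.meshDomain_finite R.isBounded h).fintype).real (Literature.Probability.Percolation.discreteCrossing R.carrier δ (R.arc 0) (R.arc 2)) else 0;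
  ∀ R : Literature.Probability.RandomPlanarGeometry.ConformalRectangle, ∀ t₁ ∈ Set.Ioo (0:ℝ) 1,
    ∃ ρ > (0:ℝ), ∀ᶠ δ in 𝓝[>] (0:ℝ), ∃ g : ℂ → ℂ,
      DifferentiableOn ℂ g (Metric.thickening ρ (((↑) : ℝ → ℂ) '' Set.Icc t₁ 1)) ∧
      ∀ t ∈ Set.Icc t₁ 1, g t = uJ R t δ

/-- STATEMENT A2 — δ-uniform off-axis bound of the extensions: for every `R`, `t₁ ∈ (0,1)` and
`ρ > 0` there are `ρ' ∈ (0, ρ]` and `M` such that, eventually as `δ → 0⁺`, every function analytic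
on the `ρ`-neighbourhood of `[t₁, 1]` that agrees with `u_R(·, δ)` on `[t₁, 1]` is bounded by `M`
on the `ρ'`-neighbourhood. -/
def UniformRatioBound : Prop :=
  let uJ : Literature.Probability.RandomPlanarGeometry.ConformalRectangle → ℝ → ℝ → ℝ := fun R t δ => if h : 0 < δ then (@Literature.Probability.LatticeModels.fkDomainMeasure R.carrier δ (t / (1 + t)) (t ^ 2) (R.arc 0 ∪ R.arc 2) (Literature.Probability.LatticeModels.meshDomain_finite R.isBounded h).fintype).real (Literature.Probability.Percolation.discreteCrossing R.carrier δ (R.arc 0) (R.arc 2)) else 0;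
  ∀ R : Literature.Probability.RandomPlanarGeometry.ConformalRectangle, ∀ t₁ ∈ Set.Ioo (0:ℝ) 1,
    ∀ ρ > (0:ℝ), ∃ ρ' ∈ Set.Ioc (0:ℝ) ρ, ∃ M : ℝ, ∀ᶠ δ in 𝓝[>] (0:ℝ), ∀ g : ℂ → ℂ,
      DifferentiableOn ℂ g (Metric.thickening ρ (((↑) : ℝ → ℂ) '' Set.Icc t₁ 1)) →
      (∀ t ∈ Set.Icc t₁ 1, g t = uJ R t δ) →
      ∀ z ∈ Metric.thickening ρ' (((↑) : ℝ → ℂ) '' Set.Icc t₁ 1), ‖g z‖ ≤ M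

/-! ### Stub statements as named propositions (hypotheses of the composition, by name) -/

/-- Statement of `stub_accLimit` (v5, the ACCUMULATION form of X_S; weaker than the window form W,
hence than stmt-6048): per conformal rectangle, the Miller–Werner crossing limit along a set of
fugacities `t ∈ (0,1]` accumulating at one point `c ∈ (0,1]`. -/
def Sig.stub_accLimit : Prop :=
  (∀ (Z U : ℝ → ℝ → ℝ) (uJ : Literature.Probability.RandomPlanarGeometry.ConformalRectangle → ℝ → ℝ → ℝ), (∀ u x, Z u x = x ^ (u / 2) * (1 - x) ^ (1 - 3 * u / 2) * ₂F₁ u (1 - u) (2 * u) x) → (∀ t η, U t η = t * Z (Real.arccos (-(t / 2)) / Real.pi) η / (Z (Real.arccos (-(t / 2)) / Real.pi) (1 - η) + t * Z (Real.arccos (-(t / 2)) / Real.pi) η)) → (∀ (R : Literature.Probability.RandomPlanarGeometry.ConformalRectangle) (t δ : ℝ), uJ R t δ = if h : 0 < δ then (@Literature.Probability.LatticeModels.fkDomainMeasure R.carrier δ (t / (1 + t)) (t ^ 2) (R.arc 0 ∪ R.arc 2) (Literature.Probability.LatticeModels.meshDomain_finite R.isBounded h).fintype).real (Literature.Probability.Percolation.discreteCrossing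 R.carrier δ (R.arc 0) (R.arc 2)) else 0) → ∀ R : Literature.Probability.RandomPlanarGeometry.ConformalRectangle, ∃ c ∈ Set.Ioc (0:ℝ) 1, ∃ᶠ t in 𝓝[≠] c, t ∈ Set.Ioc (0:ℝ) 1 ∧ R.HasCrossingLimit (fun δ => uJ R t δ) (U t))

/-- Statement of `stub_accGlue` (v5 rigidity glue at full strength: Lee–Yang crux + accumulation
form ⇒ X_S). -/
def Sig.stub_accGlue : Prop :=
  Summit.CriticalPhenomena.CardyFormulaZ2.Theses.CardyUSTContinuation.UniformAnalyticExtension → (∀ (Z U : ℝ → ℝ → ℝ) (uJ : Literature.Probability.RandomPlanarGeometry.ConformalRectangle → ℝ → ℝ → ℝ), (∀ u x, Z u x = x ^ (u / 2) * (1 - x) ^ (1 - 3 * u / 2) * ₂F₁ u (1 - u) (2 * u) x) → (∀ t η, U t η = t * Z (Real.arccos (-(t / 2)) / Real.pi) η / (Z (Real.arccos (-(t / 2)) / Real.pi) (1 - η) + t * Z (Real.arccos (-(t / 2)) / Real.pi) η)) → (∀ (R : Literature.Probability.RandomPlanarGeometry.ConformalRectangle) (t δ : ℝ), uJ R t δ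 = if h : 0 < δ then (@Literature.Probability.LatticeModels.fkDomainMeasure R.carrier δ (t / (1 + t)) (t ^ 2) (R.arc 0 ∪ R.arc 2) (Literature.Probability.LatticeModels.meshDomain_finite R.isBounded h).fintype).real (Literature.Probability.Percolation.discreteCrossing R.carrier δ (R.arc 0) (R.arc 2)) else 0) → ∀ R : Literature.Probability.RandomPlanarGeometry.ConformalRectangle, ∃ c ∈ Set.Ioc (0:ℝ) 1, ∃ᶠ t in 𝓝[≠] c, t ∈ Set.Ioc (0:ℝ) 1 ∧ R.HasCrossingLimit (fun δ => uJ R t δ) (U t)) → Summit.CriticalPhenomena.CardyFormulaZ2.Theses.CardyUSTContinuation.SmallFugacityLimit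

/-- Statement M (v7, lead c5): the MOVING-FUGACITY form of X_S — per conformal rectangle, for every
`c ∈ (0, 1]` and every schedule `τ δ → c` (`τ δ ≤ 1` eventually), crossing limit `U c` along
`u_R(τ δ, δ)`.  Stronger than `SmallFugacityLimit` (constant schedules,
`smallFugacityLimit_of_movingFugacity`); under X_A equivalent to it (stub UG). -/
def Sig.movingFugacityLimit : Prop :=
  (∀ (Z U : ℝ → ℝ → ℝ) (uJ : Literature.Probability.RandomPlanarGeometry.ConformalRectangle → ℝ → ℝ → ℝ), (∀ u x, Z u x = x ^ (u / 2) * (1 - x) ^ (1 - 3 * u / 2) * ₂F₁ u (1 - u) (2 * u) x) → (∀ t η, U t η = t * Z (Real.arccos (-(t / 2)) / Real.pi) η / (Z (Real.arccos (-(t / 2)) / Real.pi) (1 - η) + t * Z (Real.arccos (-(t / 2)) / Real.pi) η)) → (∀ (R : Literature.Probability.RandomPlanarGeometry.ConformalRectangle) (t δ : ℝ), uJ R t δ = if h : 0 < δ then (@Literature.Probability.LatticeModels.fkDomainMeasure R.carrier δ (t / (1 + t)) (t ^ 2) (R.arc 0 ∪ R.arc 2) (Literature.Probability.LatticeModels.meshDomain_finite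 R.isBounded h).fintype).real (Literature.Probability.Percolation.discreteCrossing R.carrier δ (R.arc 0) (R.arc 2)) else 0) → ∀ R : Literature.Probability.RandomPlanarGeometry.ConformalRectangle, ∀ c ∈ Set.Ioc (0:ℝ) 1, ∀ τ : ℝ → ℝ, Tendsto τ (𝓝[>] 0) (𝓝 c) → (∀ᶠ δ in 𝓝[>] (0:ℝ), τ δ ≤ 1) → R.HasCrossingLimit (fun δ => uJ R (τ δ) δ) (U c))

/-- Statement of `stub_uniformGlue` (v7 rigidity glue, UNIFORM form: Lee–Yang crux + accumulation
form ⇒ the moving-fugacity form M, by Vitali–Porter uniformly on compacts). -/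
def Sig.stub_uniformGlue : Prop :=
  Summit.CriticalPhenomena.CardyFormulaZ2.Theses.CardyUSTContinuation.UniformAnalyticExtension → (∀ (Z U : ℝ → ℝ → ℝ) (uJ : Literature.Probability.RandomPlanarGeometry.ConformalRectangle → ℝ → ℝ → ℝ), (∀ u x, Z u x = x ^ (u / 2) * (1 - x) ^ (1 - 3 * u / 2) * ₂F₁ u (1 - u) (2 * u) x) → (∀ t η, U t η = t * Z (Real.arccos (-(t / 2)) / Real.pi) η / (Z (Real.arccos (-(t / 2)) / Real.pi) (1 - η) + t * Z (Real.arccos (-(t / 2)) / Real.pi) η)) → (∀ (R : Literature.Probability.RandomPlanarGeometry.ConformalRectangle) (t δ : ℝ), uJ R t δ = if h : 0 < δ then (@Literature.Probability.LatticeModels.fkDomainMeasure R.carrier δ (t / (1 + t)) (t ^ 2) (R.arc 0 ∪ R.arc 2) (Literature.Probability.LatticeModels.meshDomain_finite R.isBounded h).fintype).real (Literature.Probability.Percolation.discreteCrossing R.carrier δ (R.arc 0) (R.arc 2)) else 0) → ∀ R : Literature.Probability.RandomPlanarGeometry.ConformalRectangle, ∃ c ∈ Set.Ioc (0:ℝ)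 1, ∃ᶠ t in 𝓝[≠] c, t ∈ Set.Ioc (0:ℝ) 1 ∧ R.HasCrossingLimit (fun δ => uJ R t δ) (U t)) → (∀ (Z U : ℝ → ℝ → ℝ) (uJ : Literature.Probability.RandomPlanarGeometry.ConformalRectangle → ℝ → ℝ → ℝ), (∀ u x, Z u x = x ^ (u / 2) * (1 - x) ^ (1 - 3 * u / 2) * ₂F₁ u (1 - u) (2 * u) x) → (∀ t η, U t η = t * Z (Real.arccos (-(t / 2)) / Real.pi) η / (Z (Real.arccos (-(t / 2)) / Real.pi) (1 - η) + t * Z (Real.arccos (-(t / 2)) / Real.pi) η)) → (∀ (R : Literature.Probability.RandomPlanarGeometry.ConformalRectangle) (t δ : ℝ), uJ R t δ = if h : 0 < δ then (@Literature.Probability.LatticeModels.fkDomainMeasure R.carrier δ (t / (1 + t)) (t ^ 2) (R.arc 0 ∪ R.arc 2) (Literature.Probability.LatticeModels.meshDomain_finite R.isBounded h).fintype).real (Literature.Probability.Percolation.discreteCrossing R.carrier δ (R.arc 0) (R.arc 2)) else 0) → ∀ R : Literature.Probability.RandomPlanarGeometry.ConformalRectangle, ∀ c ∈ Set.Ioc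 (0:ℝ) 1, ∀ τ : ℝ → ℝ, Tendsto τ (𝓝[>] 0) (𝓝 c) → (∀ᶠ δ in 𝓝[>] (0:ℝ), τ δ ≤ 1) → R.HasCrossingLimit (fun δ => uJ R (τ δ) δ) (U c))

/-- Statement W of v3/v4 (the WINDOW form of X_S; weaker than stmt-6048; in v5 no longer a stub:
it implies the registered W′, `accLimit_of_windowLimit`). -/
def Sig.stub_windowLimit : Prop :=
  (∀ (Z U : ℝ → ℝ → ℝ) (uJ : Literature.Probability.RandomPlanarGeometry.ConformalRectangle → ℝ → ℝ → ℝ), (∀ u x, Z u x = x ^ (u / 2) * (1 - x) ^ (1 - 3 * u / 2) * ₂F₁ u (1 - u) (2 * u) x) → (∀ t η, U t η = t * Z (Real.arccos (-(t / 2)) / Real.pi) η / (Z (Real.arccos (-(t / 2)) / Real.pi) (1 - η) + t * Z (Real.arccos (-(t / 2)) / Real.pi) η)) → (∀ (R : Literature.Probability.RandomPlanarGeometry.ConformalRectangle) (t δ : ℝ), uJ R t δ = if h : 0 < δ then (@Literature.Probability.LatticeModels.fkDomainMeasure R.carrier δ (t / (1 + t)) (t ^ 2) (R.arc 0 ∪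 R.arc 2) (Literature.Probability.LatticeModels.meshDomain_finite R.isBounded h).fintype).real (Literature.Probability.Percolation.discreteCrossing R.carrier δ (R.arc 0) (R.arc 2)) else 0) → ∀ R : Literature.Probability.RandomPlanarGeometry.ConformalRectangle, ∃ a b : ℝ, 0 < a ∧ a < b ∧ b ≤ 1 ∧ ∀ t ∈ Set.Ioo a b, R.HasCrossingLimit (fun δ => uJ R t δ) (U t))

/-- Statement of `stub_windowGlue` (rigidity glue: Lee–Yang crux + window form ⇒ X_S). -/
def Sig.stub_windowGlue : Prop :=
  Summit.CriticalPhenomena.CardyFormulaZ2.Theses.CardyUSTContinuation.UniformAnalyticExtension → (∀ (Z U : ℝ → ℝ → ℝ) (uJ : Literature.Probability.RandomPlanarGeometry.ConformalRectangle → ℝ → ℝ → ℝ), (∀ u x, Z u x = x ^ (u / 2) * (1 - x) ^ (1 - 3 * u / 2) * ₂F₁ u (1 - u) (2 * u) x) → (∀ t η, U t η = t * Z (Real.arccos (-(t / 2)) / Real.pi) η / (Z (Real.arccos (-(t / 2)) / Real.pi) (1 - η) + t * Z (Real.arccos (-(t / 2)) / Real.pi) η)) → (∀ (R : Literature.Probability.RandomPlanarGeometry.ConformalRectangle)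 (t δ : ℝ), uJ R t δ = if h : 0 < δ then (@Literature.Probability.LatticeModels.fkDomainMeasure R.carrier δ (t / (1 + t)) (t ^ 2) (R.arc 0 ∪ R.arc 2) (Literature.Probability.LatticeModels.meshDomain_finite R.isBounded h).fintype).real (Literature.Probability.Percolation.discreteCrossing R.carrier δ (R.arc 0) (R.arc 2)) else 0) → ∀ R : Literature.Probability.RandomPlanarGeometry.ConformalRectangle, ∃ a b : ℝ, 0 < a ∧ a < b ∧ b ≤ 1 ∧ ∀ t ∈ Set.Ioo a b, R.HasCrossingLimit (fun δ => uJ R t δ) (U t)) → Summit.CriticalPhenomena.CardyFormulaZ2.Theses.CardyUSTContinuation.SmallFugacityLimit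

/-! ### The registered stubs (v8: A, W′ are the only `sorry`s of this file; G, G′, UG are landed) -/

/-- STUB A — the route crux `UniformAnalyticExtension` (stmt-CriticalPhenomena-6047) by name. -/
theorem stub_uniformAnalyticExtension : UniformAnalyticExtension := by
  sorry

/-- STUB W′ — the ACCUMULATION form of the small-fugacity crux: for every conformal rectangle
`R` there is a point `c ∈ (0, 1]` at which the fugacities `t ∈ (0, 1]` with crossing limit
`u_R(t, ·) → U(t, ·)` (Miller–Werner law, joint wiring) accumulate (`∃ᶠ t in 𝓝[≠] c, …`).
Weaker than the window form W (`accLimit_of_windowLimit`), hence than stmt-6048. -/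
theorem stub_accLimit : (∀ (Z U : ℝ → ℝ → ℝ) (uJ : Literature.Probability.RandomPlanarGeometry.ConformalRectangle → ℝ → ℝ → ℝ), (∀ u x, Z u x = x ^ (u / 2) * (1 - x) ^ (1 - 3 * u / 2) * ₂F₁ u (1 - u) (2 * u) x) → (∀ t η, U t η = t * Z (Real.arccos (-(t / 2)) / Real.pi) η / (Z (Real.arccos (-(t / 2)) / Real.pi) (1 - η) + t * Z (Real.arccos (-(t / 2)) / Real.pi) η)) → (∀ (R : Literature.Probability.RandomPlanarGeometry.ConformalRectangle) (t δ : ℝ), uJ R t δ = if h : 0 < δ then (@Literature.Probability.LatticeModels.fkDomainMeasure R.carrier δ (t / (1 + t)) (t ^ 2) (R.arc 0 ∪ R.arc 2) (Literature.Probability.LatticeModels.meshDomain_finite R.isBounded h).fintype).real (Literature.Probability.Percolation.discreteCrossing R.carrier δ (R.arc 0) (R.arc 2)) else 0) → ∀ R : Literature.Probability.RandomPlanarGeometry.ConformalRectangle, ∃ c ∈ Set.Ioc (0:ℝ) 1, ∃ᶠ t in 𝓝[≠] c, t ∈ Set.Ioc (0:ℝ) 1 ∧ R.HasCrossingLimit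 (fun δ => uJ R t δ) (U t)) := by
  sorry

-- STUB UG `stub_uniformGlue : Sig.stub_uniformGlue` is LANDED (lead c5, p155359):
-- `Theorems/CardyUSTContinuationTargetUniform.lean`, same name + namespace + signature, imported above.

/-- Wiring check: the landed stub UG has exactly the registered signature `Sig.stub_uniformGlue`. -/
example : Sig.stub_uniformGlue := stub_uniformGlue

-- STUB G′ `stub_accGlue : Sig.stub_accGlue` is LANDED (lead c4, p152601):
-- `Theorems/CardyUSTContinuationTargetAccumulation.lean`, same name + namespace + signature, imported above.

/-- Wiring check: the landed stub G′ has exactly the registered signature `Sig.stub_accGlue`. -/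
example : Sig.stub_accGlue := stub_accGlue

-- STUB G `stub_windowGlue : Sig.stub_windowGlue` is LANDED (lead c3, p149449):
-- `Theorems/CardyUSTContinuationTargetStubWindowGlue.lean`, same name + namespace + signature, imported above.

/-- Wiring check: the landed stub G has exactly the registered signature `Sig.stub_windowGlue`. -/
example : Sig.stub_windowGlue := stub_windowGlue

/-! ### Sorry-free: W is implied by the sibling crux stmt-6048 (so W is not false unless S is) -/

/-- `SmallFugacityLimit → W`: take the window `(t₀'/4, t₀'/2)`, `t₀' := min t₀ 1`. No `sorry`. -/
theorem windowLimit_of_smallFugacityLimit (hS : SmallFugacityLimit) : Sig.stub_windowLimit := by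
  unfold SmallFugacityLimit at hS
  unfold Sig.stub_windowLimit
  intro Z U uJ hZ hU huJ R
  obtain rfl : U = fun t η => t * Z (Real.arccos (-(t / 2)) / Real.pi) η /
      (Z (Real.arccos (-(t / 2)) / Real.pi) (1 - η) + t * Z (Real.arccos (-(t / 2)) / Real.pi) η) :=
    funext fun t => funext fun η => hU t η
  obtain rfl : Z = fun u x => x ^ (u / 2) * (1 - x) ^ (1 - 3 * u / 2) * ₂F₁ u (1 - u) (2 * u) x :=
    funext fun u => funext fun x => hZ u x
  obtain rfl : uJ = fun R t δ => if h : 0 < δ then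
      (@Literature.Probability.LatticeModels.fkDomainMeasure R.carrier δ (t / (1 + t)) (t ^ 2)
        (R.arc 0 ∪ R.arc 2)
        (Literature.Probability.LatticeModels.meshDomain_finite R.isBounded h).fintype).real
        (Literature.Probability.Percolation.discreteCrossing R.carrier δ (R.arc 0) (R.arc 2)) else 0 :=
    funext fun R => funext fun t => funext fun δ => huJ R t δ
  obtain ⟨t₀, ht₀, hSR⟩ := hS R
  have hm : 0 < min t₀ 1 := lt_min ht₀ one_pos
  refine ⟨min t₀ 1 / 4, min t₀ 1 / 2, by positivity, by linarith, by linarith [min_le_right t₀ 1],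
    fun t ht => hSR t ⟨lt_trans (by positivity) ht.1, ?_⟩⟩
  linarith [ht.2, min_le_left t₀ 1]

/-! ### Sorry-free (v5): the window form W gives the accumulation form W′ -/

/-- `W → W′`: the good fugacities of a window `(a, b)` accumulate at its midpoint. No `sorry`. -/
theorem accLimit_of_windowLimit (hW : Sig.stub_windowLimit) : Sig.stub_accLimit := by
  unfold Sig.stub_windowLimit at hW
  unfold Sig.stub_accLimit
  intro Z U uJ hZ hU huJ R
  obtain ⟨a, b, ha, hab, hb, hWR⟩ := hW Z U uJ hZ hU huJ R
  refine ⟨(a + b) / 2, ⟨by linarith, by linarith⟩, ?_⟩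
  have hnear : ∀ᶠ t in 𝓝[≠] ((a + b) / 2), t ∈ Set.Ioo a b :=
    mem_nhdsWithin_of_mem_nhds (isOpen_Ioo.mem_nhds ⟨by linarith, by linarith⟩)
  exact (hnear.mono fun t ht => ⟨⟨ha.trans ht.1, ht.2.le.trans hb⟩, hWR t ht⟩).frequently

/-- `SmallFugacityLimit → W′` (so W′ is not false unless stmt-6048 is). No `sorry`. -/
theorem accLimit_of_smallFugacityLimit (hS : SmallFugacityLimit) : Sig.stub_accLimit :=
  accLimit_of_windowLimit (windowLimit_of_smallFugacityLimit hS)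

/-! ### Proved: the birth cut {A1, A2} is equivalent to the crux `UniformAnalyticExtension` -/

/-- A1 and A2 give the route crux `UniformAnalyticExtension` (stmt-CriticalPhenomena-6047):
take `ρ` and the extensions from A1, then `ρ' ≤ ρ` and `M` from A2 at that `ρ`, and restrict the
extensions to the `ρ'`-neighbourhood (`Metric.thickening_mono`). No `sorry` (birth, v1). -/
theorem uniformAnalyticExtension_of (h1 : ZeroFreeExtension) (h2 : UniformRatioBound) :
    UniformAnalyticExtension := by
  unfold UniformAnalyticExtension
  unfold ZeroFreeExtension at h1
  unfold UniformRatioBound at h2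
  intro uJ R t₁ ht₁
  obtain ⟨ρ, hρ, hg⟩ := h1 R t₁ ht₁
  obtain ⟨ρ', hρ', M, hM⟩ := h2 R t₁ ht₁ ρ hρ
  refine ⟨ρ', hρ'.1, M, ?_⟩
  filter_upwards [hg, hM] with δ hgδ hMδ
  obtain ⟨g, hgd, hgt⟩ := hgδ
  exact ⟨g, hgd.mono (Metric.thickening_mono hρ'.2 _), fun z hz => hMδ g hgd hgt z hz, hgt⟩

/-- The crux `UniformAnalyticExtension` gives back A1 (drop the bound). No `sorry` (birth, v1). -/
theorem zeroFreeExtension_of (hA : UniformAnalyticExtension) : ZeroFreeExtension := by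
  unfold UniformAnalyticExtension at hA
  unfold ZeroFreeExtension
  intro uJ R t₁ ht₁
  obtain ⟨ρ, hρ, M, hev⟩ := hA R t₁ ht₁
  refine ⟨ρ, hρ, ?_⟩
  filter_upwards [hev] with δ hδ
  obtain ⟨g, hgd, -, hgt⟩ := hδ
  exact ⟨g, hgd, hgt⟩

/-- The complex segment `[t₁, 1] ⊂ ℂ` (image of `Set.Icc t₁ 1` under `ℝ → ℂ`) is convex. -/
theorem convex_ofReal_image_Icc (t₁ : ℝ) : Convex ℝ (((↑) : ℝ → ℂ) '' Set.Icc t₁ 1) := by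
  rintro _ ⟨a, ha, rfl⟩ _ ⟨b, hb, rfl⟩ u v hu hv huv
  refine ⟨u * a + v * b, ?_, by push_cast; simp⟩
  have h := (convex_Icc t₁ 1) ha hb hu hv huv
  simpa [smul_eq_mul] using h

/-- Identity theorem on a thickening of the complex segment `[t₁,1]` (`t₁ < 1`): two functions
complex-differentiable on the open convex set `Metric.thickening ρ [t₁,1]` that agree at the real
points of `[t₁, 1]` agree on the whole thickening. -/
theorem eqOn_thickening_of_eqOn_Icc {t₁ ρ : ℝ} (ht₁ : t₁ < 1) (hρ : 0 < ρ) {g g' : ℂ → ℂ}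
    (hg : DifferentiableOn ℂ g (Metric.thickening ρ (((↑) : ℝ → ℂ) '' Set.Icc t₁ 1)))
    (hg' : DifferentiableOn ℂ g' (Metric.thickening ρ (((↑) : ℝ → ℂ) '' Set.Icc t₁ 1)))
    (h : ∀ t ∈ Set.Icc t₁ 1, g t = g' t) :
    EqOn g g' (Metric.thickening ρ (((↑) : ℝ → ℂ) '' Set.Icc t₁ 1)) := by
  set S : Set ℂ := ((↑) : ℝ → ℂ) '' Set.Icc t₁ 1 with hSdef
  set t₀ : ℝ := (t₁ + 1) / 2 with ht₀def
  have ht₀ : t₀ ∈ Set.Icc t₁ 1 := ⟨by rw [ht₀def]; linarith, by rw [ht₀def]; linarith⟩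
  have ht₀S : (t₀ : ℂ) ∈ Metric.thickening ρ S := Metric.self_subset_thickening hρ S ⟨t₀, ht₀, rfl⟩
  have hA1 : AnalyticOnNhd ℂ g (Metric.thickening ρ S) := hg.analyticOnNhd Metric.isOpen_thickening
  have hA2 : AnalyticOnNhd ℂ g' (Metric.thickening ρ S) := hg'.analyticOnNhd Metric.isOpen_thickening
  have hfreq : ∃ᶠ z in 𝓝[≠] (t₀ : ℂ), g z = g' z := by
    have hT : Tendsto ((↑) : ℝ → ℂ) (𝓝[≠] t₀) (𝓝[≠] (t₀ : ℂ)) := by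
      refine tendsto_nhdsWithin_iff.2 ⟨Complex.continuous_ofReal.continuousAt.tendsto.mono_left
        nhdsWithin_le_nhds, ?_⟩
      filter_upwards [self_mem_nhdsWithin] with t ht
      simpa using ht
    refine hT.frequently ?_
    have hIcc : ∀ᶠ t in 𝓝[≠] t₀, t ∈ Set.Icc t₁ 1 :=
      mem_nhdsWithin_of_mem_nhds (Icc_mem_nhds (by rw [ht₀def]; linarith)
        (by rw [ht₀def]; linarith))
    exact (hIcc.mono fun t ht => h t ht).frequently
  exact hA1.eqOn_of_preconnected_of_frequently_eq hA2
    ((convex_ofReal_image_Icc t₁).thickening ρ).isPreconnected ht₀S hfreq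

/-- The crux `UniformAnalyticExtension` gives A2 (v2, lead c2): given `ρ`, take
`ρ' = min ρ ρ_A` with `ρ_A, M` from the crux; any analytic `g` on the `ρ`-thickening agreeing with
`u_R(·, δ)` on `[t₁, 1]` agrees there with the crux's extension `g_A`, hence (identity theorem on
the convex `ρ'`-thickening) `g = g_A` on it and `‖g‖ ≤ M` there. No `sorry`. -/
theorem uniformRatioBound_of (hA : UniformAnalyticExtension) : UniformRatioBound := by
  unfold UniformAnalyticExtension at hA
  unfold UniformRatioBound
  intro uJ R t₁ ht₁ ρ hρ
  obtain ⟨ρA, hρA, M, hev⟩ := hA R t₁ ht₁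
  refine ⟨min ρ ρA, ⟨lt_min hρ hρA, min_le_left _ _⟩, M, ?_⟩
  filter_upwards [hev] with δ hδ
  obtain ⟨gA, hgAd, hgAM, hgAt⟩ := hδ
  intro g hgd hgt z hz
  have h1 : DifferentiableOn ℂ g (Metric.thickening (min ρ ρA) (((↑) : ℝ → ℂ) '' Set.Icc t₁ 1)) :=
    hgd.mono (Metric.thickening_mono (min_le_left _ _) _)
  have h2 : DifferentiableOn ℂ gA (Metric.thickening (min ρ ρA) (((↑) : ℝ → ℂ) '' Set.Icc t₁ 1)) :=
    hgAd.mono (Metric.thickening_mono (min_le_right _ _) _)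
  have h3 : ∀ t ∈ Set.Icc t₁ 1, g t = gA t := fun t ht => (hgt t ht).trans (hgAt t ht).symm
  have hEq := eqOn_thickening_of_eqOn_Icc ht₁.2 (lt_min hρ hρA) h1 h2 h3
  rw [hEq hz]
  exact hgAM z (Metric.thickening_mono (min_le_right _ _) _ hz)

/-- **Normal form of the birth cut**: `UniformAnalyticExtension ↔ ZeroFreeExtension ∧ UniformRatioBound`
— the v1 stubs A1, A2 are jointly EQUIVALENT to the sibling crux stmt-CriticalPhenomena-6047, so
registering that crux by name (v2) loses nothing and duplicates no seat. No `sorry`. -/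
theorem uniformAnalyticExtension_iff :
    UniformAnalyticExtension ↔ (ZeroFreeExtension ∧ UniformRatioBound) :=
  ⟨fun h => ⟨zeroFreeExtension_of h, uniformRatioBound_of h⟩,
    fun h => uniformAnalyticExtension_of h.1 h.2⟩

/-! ### Sorry-free (v4): the route closes from ONE window and ONE segment (planner-facing) -/

/-- **Window data suffice for the sub-problem.**  If for every conformal rectangle `R` there are
`0 < t₁ ≤ a < b ≤ 1`, δ-uniform bounded analytic extensions of `t ↦ u_R(t, δ)` near the ONE
segment `[t₁, 1]`, and crossing limits `u_R(t, ·) → U(t, ·)` on the ONE window `(a, b)`, then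
`CardyFormulaZ2` holds — by the landed `hasCrossingLimit_cardy_of_window`, `bernoulliEndpoint_proof`
and `continuumFamily_proof`.  (`Target` asks for more: X_A near `[t₁, 1]` for EVERY `t₁ ∈ (0,1)`
and X_S on a window `(0, t₀)` at the tree point.)  The `let`s are characterised as in stub W. -/
theorem cardyFormulaZ2_of_windowData
    (h : ∀ (Z U : ℝ → ℝ → ℝ) (uJ : Literature.Probability.RandomPlanarGeometry.ConformalRectangle → ℝ → ℝ → ℝ), (∀ u x, Z u x = x ^ (u / 2) * (1 - x) ^ (1 - 3 * u / 2) * ₂F₁ u (1 - u) (2 * u) x) → (∀ t η, U t η = t * Z (Real.arccos (-(t / 2)) / Real.pi) η / (Z (Real.arccos (-(t / 2)) / Real.pi) (1 - η) + t * Z (Real.arccos (-(t / 2)) / Real.pi) η)) → (∀ (R : Literature.Probability.RandomPlanarGeometry.ConformalRectangle) (t δ : ℝ), uJ R t δ = if h : 0 < δ then (@Literature.Probability.LatticeModels.fkDomainMeasure R.carrier δ (t / (1 + t)) (t ^ 2) (R.arc 0 ∪ R.arc 2) (Literature.Probability.LatticeModels.meshDomain_finite R.isBounded h).fintype).real (Literature.Probability.Percolation.discreteCrossing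 R.carrier δ (R.arc 0) (R.arc 2)) else 0) →
      ∀ R : Literature.Probability.RandomPlanarGeometry.ConformalRectangle, ∃ t₁ a b : ℝ,
        0 < t₁ ∧ t₁ ≤ a ∧ a < b ∧ b ≤ 1 ∧
        (∃ ρ > (0:ℝ), ∃ M : ℝ, ∀ᶠ δ in 𝓝[>] (0:ℝ), ∃ g : ℂ → ℂ,
          DifferentiableOn ℂ g (Metric.thickening ρ (((↑) : ℝ → ℂ) '' Set.Icc t₁ 1)) ∧
          (∀ z ∈ Metric.thickening ρ (((↑) : ℝ → ℂ) '' Set.Icc t₁ 1), ‖g z‖ ≤ M) ∧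
          ∀ t ∈ Set.Icc t₁ 1, g t = uJ R t δ) ∧
        ∀ t ∈ Set.Ioo a b, R.HasCrossingLimit (fun δ => uJ R t δ) (U t)) :
    _root_.CardyFormulaZ2 := by
  have hB := Summit.CriticalPhenomena.CardyFormulaZ2.Theorems.bernoulliEndpoint_proof
  have hC := Summit.CriticalPhenomena.CardyFormulaZ2.Theorems.continuumFamily_proof
  unfold BernoulliEndpoint at hB
  unfold ContinuumFamily at hC
  intro R
  obtain ⟨t₁, a, b, ht₁, ht₁a, hab, hb, hA₁, hW⟩ :=
    h _ _ _ (fun _ _ => rfl) (fun _ _ => rfl) (fun _ _ _ => rfl) R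
  refine Summit.CriticalPhenomena.CardyFormulaZ2.Theorems.hasCrossingLimit_cardy_of_window _ _ R
    ht₁ ht₁a hab hb hA₁ hW ?_ hC.1 hC.2
  intro δ hδ
  simp only [dif_pos hδ]
  exact hB R δ hδ

/-- Conversely `Target` gives the window data (take `t₁ = a = t₀'/4`, `b = t₀'/2`, `t₀' := min t₀ 1`),
so `WindowData` sits between `Target` and `CardyFormulaZ2`. No `sorry`. -/
theorem windowData_of_target
    (hT : Summit.CriticalPhenomena.CardyFormulaZ2.Theses.CardyUSTContinuation.Target) :
    ∀ (Z U : ℝ → ℝ → ℝ) (uJ : Literature.Probability.RandomPlanarGeometry.ConformalRectangle → ℝ → ℝ → ℝ), (∀ u x, Z u x = x ^ (u / 2) * (1 - x) ^ (1 - 3 * u / 2) * ₂F₁ u (1 - u) (2 * u) x) → (∀ t η, U t η = t * Z (Real.arccos (-(t / 2)) / Real.pi) η / (Z (Real.arccos (-(t / 2)) / Real.pi) (1 - η) + t * Z (Real.arccos (-(t / 2)) / Real.pi) η)) → (∀ (R : Literature.Probability.RandomPlanarGeometry.ConformalRectangle) (t δ : ℝ), uJ R t δ = if h : 0 < δ then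 (@Literature.Probability.LatticeModels.fkDomainMeasure R.carrier δ (t / (1 + t)) (t ^ 2) (R.arc 0 ∪ R.arc 2) (Literature.Probability.LatticeModels.meshDomain_finite R.isBounded h).fintype).real (Literature.Probability.Percolation.discreteCrossing R.carrier δ (R.arc 0) (R.arc 2)) else 0) →
      ∀ R : Literature.Probability.RandomPlanarGeometry.ConformalRectangle, ∃ t₁ a b : ℝ,
        0 < t₁ ∧ t₁ ≤ a ∧ a < b ∧ b ≤ 1 ∧
        (∃ ρ > (0:ℝ), ∃ M : ℝ, ∀ᶠ δ in 𝓝[>] (0:ℝ), ∃ g : ℂ → ℂ,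
          DifferentiableOn ℂ g (Metric.thickening ρ (((↑) : ℝ → ℂ) '' Set.Icc t₁ 1)) ∧
          (∀ z ∈ Metric.thickening ρ (((↑) : ℝ → ℂ) '' Set.Icc t₁ 1), ‖g z‖ ≤ M) ∧
          ∀ t ∈ Set.Icc t₁ 1, g t = uJ R t δ) ∧
        ∀ t ∈ Set.Ioo a b, R.HasCrossingLimit (fun δ => uJ R t δ) (U t) := by
  have hS : SmallFugacityLimit := hT.1
  have hA : UniformAnalyticExtension := hT.2
  unfold SmallFugacityLimit at hS
  unfold UniformAnalyticExtension at hA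
  intro Z U uJ hZ hU huJ R
  obtain rfl : U = fun t η => t * Z (Real.arccos (-(t / 2)) / Real.pi) η /
      (Z (Real.arccos (-(t / 2)) / Real.pi) (1 - η) + t * Z (Real.arccos (-(t / 2)) / Real.pi) η) :=
    funext fun t => funext fun η => hU t η
  obtain rfl : Z = fun u x => x ^ (u / 2) * (1 - x) ^ (1 - 3 * u / 2) * ₂F₁ u (1 - u) (2 * u) x :=
    funext fun u => funext fun x => hZ u x
  obtain rfl : uJ = fun R t δ => if h : 0 < δ then
      (@Literature.Probability.LatticeModels.fkDomainMeasure R.carrier δ (t / (1 + t)) (t ^ 2)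
        (R.arc 0 ∪ R.arc 2)
        (Literature.Probability.LatticeModels.meshDomain_finite R.isBounded h).fintype).real
        (Literature.Probability.Percolation.discreteCrossing R.carrier δ (R.arc 0) (R.arc 2)) else 0 :=
    funext fun R => funext fun t => funext fun δ => huJ R t δ
  obtain ⟨t₀, ht₀, hSR⟩ := hS R
  have hm : 0 < min t₀ 1 := lt_min ht₀ one_pos
  have hm1 : min t₀ 1 ≤ 1 := min_le_right t₀ 1
  have ht₁ : min t₀ 1 / 4 ∈ Set.Ioo (0:ℝ) 1 := ⟨by positivity, by linarith⟩
  obtain ⟨ρ, hρ, M, hAev⟩ := hA R (min t₀ 1 / 4) ht₁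
  refine ⟨min t₀ 1 / 4, min t₀ 1 / 4, min t₀ 1 / 2, by positivity, le_rfl, by linarith, by linarith,
    ⟨ρ, hρ, M, hAev⟩, fun t ht => hSR t ⟨lt_trans (by positivity) ht.1, ?_⟩⟩
  linarith [ht.2, min_le_left t₀ 1]

/-! ### Sorry-free (v7): the moving-fugacity form M gives `SmallFugacityLimit` (constant schedules) -/

/-- `M → SmallFugacityLimit`: take `t₀ = 1` and the constant schedule `τ ≡ t` for `t ∈ (0, 1)`.
No `sorry`. -/
theorem smallFugacityLimit_of_movingFugacity (hM : Sig.movingFugacityLimit) : SmallFugacityLimit := by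
  unfold Sig.movingFugacityLimit at hM
  unfold SmallFugacityLimit
  intro Z U uJ R
  refine ⟨1, one_pos, fun t ht => ?_⟩
  exact hM Z U uJ (fun _ _ => rfl) (fun _ _ => rfl) (fun _ _ _ => rfl) R t ⟨ht.1, ht.2.le⟩
    (fun _ => t) tendsto_const_nhds (Eventually.of_forall fun _ => ht.2.le)

/-- `W′ ⇐ M` directly as well (constant schedules accumulate everywhere): M sits between
`Target` and the registered stub W′. No `sorry`. -/
theorem accLimit_of_movingFugacity (hM : Sig.movingFugacityLimit) : Sig.stub_accLimit :=
  accLimit_of_smallFugacityLimit (smallFugacityLimit_of_movingFugacity hM)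

/-! ### The composition: the stubs imply the crux, BY NAME (kernel-checked, no `sorry`) -/

/-- **Composition** (v7): the open stubs A, W′ give the crux BY NAME — stub UG (`stub_uniformGlue`)
turns `A, W′` into the moving-fugacity form M, `smallFugacityLimit_of_movingFugacity` turns M into
`SmallFugacityLimit`, and `Target` is the conjunction `⟨X_S, X_A⟩` after unfolding the shared `let`s. -/
theorem Target_of :
    Summit.CriticalPhenomena.CardyFormulaZ2.Theses.CardyUSTContinuation.UniformAnalyticExtension →
      Sig.stub_accLimit →
      Summit.CriticalPhenomena.CardyFormulaZ2.Theses.CardyUSTContinuation.Target := by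
  intro hA hW
  -- stub UG is LANDED (p155359): A, W′ give the moving-fugacity form M, and M gives X_S
  have hUG : Sig.stub_uniformGlue := stub_uniformGlue
  have hM : Sig.movingFugacityLimit := hUG hA hW
  have hS : SmallFugacityLimit := smallFugacityLimit_of_movingFugacity hM
  unfold Target
  unfold SmallFugacityLimit at hS
  unfold UniformAnalyticExtension at hA
  exact ⟨hS, hA⟩

/-- The v5/v6 composition remains available: A, W′ give `Target` through the landed stub G′
(`stub_accGlue`, p152601) alone. No `sorry`. -/
theorem Target_of_acc :
    Summit.CriticalPhenomena.CardyFormulaZ2.Theses.CardyUSTContinuation.UniformAnalyticExtension →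
      Sig.stub_accLimit →
      Summit.CriticalPhenomena.CardyFormulaZ2.Theses.CardyUSTContinuation.Target := by
  intro hA hW
  have hG : Sig.stub_accGlue := stub_accGlue
  have hS : SmallFugacityLimit := hG hA hW
  unfold Target
  unfold SmallFugacityLimit at hS
  unfold UniformAnalyticExtension at hA
  exact ⟨hS, hA⟩

/-- The v4 composition remains available: A, W give `Target` (W → W′). -/
theorem Target_of_window
    (hA : Summit.CriticalPhenomena.CardyFormulaZ2.Theses.CardyUSTContinuation.UniformAnalyticExtension)
    (hW : Sig.stub_windowLimit) :
    Summit.CriticalPhenomena.CardyFormulaZ2.Theses.CardyUSTContinuation.Target :=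
  Target_of hA (accLimit_of_windowLimit hW)

/-- Sanity (kernel-checked): the crux IS the conjunction of the two interval cruxes, definitionally. -/
theorem target_iff : Summit.CriticalPhenomena.CardyFormulaZ2.Theses.CardyUSTContinuation.Target ↔
    (SmallFugacityLimit ∧ UniformAnalyticExtension) := Iff.rfl

/-- Wiring check: the registered stubs feed `Target_of` as stated. -/
example : Summit.CriticalPhenomena.CardyFormulaZ2.Theses.CardyUSTContinuation.Target :=
  Target_of stub_uniformAnalyticExtension stub_accLimit

/-- Wiring check (v2 composition still available): the sibling cruxes S, A give `Target`. -/
example (hS : SmallFugacityLimit) (hA : UniformAnalyticExtension) :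
    Summit.CriticalPhenomena.CardyFormulaZ2.Theses.CardyUSTContinuation.Target :=
  Target_of hA (accLimit_of_smallFugacityLimit hS)

/-- Wiring check (v1 composition still available): S, A1, A2 give `Target`. -/
example (hS : SmallFugacityLimit) (h1 : ZeroFreeExtension) (h2 : UniformRatioBound) :
    Summit.CriticalPhenomena.CardyFormulaZ2.Theses.CardyUSTContinuation.Target :=
  Target_of (uniformAnalyticExtension_of h1 h2) (accLimit_of_smallFugacityLimit hS)

end Summit.CriticalPhenomena.CardyFormulaZ2.Cruxes.Target.CardyUSTContinuationBirth

end
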